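import Mathlib.Data.ZMod.Basic
import Mathlib.Data.Finset.Powerset
import Mathlib.Data.Finset.Card
import Mathlib.Data.Fintype.Sum
import Mathlib.Data.Fintype.Powerset
import HarnessLib

/-!
# Rank-four faces of a cyclic sextic CM field: every face is "three twists of the simple threefold + the CM
# elliptic curve", and its Weil line is the pair of Weil classes of the fourfold `B × E` — a kernel census

COR-CM (cell `pub-hodgecm2`), literature seat André-3 (portfolio pass, 2026-08-20/21).  A finite, kernel-decided
computation (no named fact, no geometry, no `sorry`) certifying the combinatorial half of FINDING F-6 of
`HOME/pub-hodgecm2-lit-andre-3/PORTFOLIO-lit-andre-3.md` §3 / `…-g2.md` §2–§3 (the degree-6 slice of `Universe.W_RK4`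
reduces to Markman's theorem on Weil classes of abelian FOURFOLDS): for a Galois CM field `F` of degree `6` the Galois
group is cyclic, `G = ℤ/6 = ⟨σ⟩`, complex conjugation `c = σ³`, `k = F^{⟨σ²⟩}` the imaginary quadratic subfield.

MODEL (the statement of the theorems; dictionary cited).  Embeddings `Hom(F, ℚ̄) = {s₀ ∘ σⁱ} ≅ ℤ/6`; a CM type is a
subset `T ⊂ ℤ/6` containing exactly one of `i, i + 3`; twisting the action by `σᵐ` is `T ↦ T + m` (same variety);
`T` is induced from `k` iff `T + 2 = T` (then `A_T ~ E³`, `E` the CM elliptic curve of `k`), otherwise `T` is primitive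
and `A_T` is a twist of ONE simple CM threefold `B` (the primitive types form a single translation orbit).  The three
infinite places of `F` are the pairs `{i, i+3}`, `i ∈ {0,1,2}`; the corners of the face `(Φ; π, π′)`, `π ≠ π′`, are
`Φ, (Φ̄)^{(π)}, (Φ̄)^{(π′)}, Φ^{(ππ′)}` with `Φ̄ = Φ + 3` and `T^{(π)} = T ∆ {π, π+3}` — verbatim the tree's
`Summit.HodgeConjecture.CorCM.Face.corner` (`CorCM/CM/Basic.lean`) read in this model [cite: Andre1992HodgeCM, p. 2]
(rank-four Weil lines of CM products), [folklore] (types of a cyclic CM field).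

RESULTS (kernel): (1) `sumTwo`: every embedding lies in exactly two corners (the Weil line is of Hodge type `(2,2)`);
(2) `corner_structure`: every one of the `8 · 6 = 48` faces has exactly ONE `k`-induced corner, and its three primitive
corners form a full packet `{Ψ, Ψ+2, Ψ+4}` — so the corner product is isogenous to `B × B × B × E³` with the three
copies of `B` twisted by a coset of `Gal(F/k)`, and the face Weil line collapses (portfolio note §3.1) onto the CM
fourfold `Y = B × E`; (3) `card_hodgeSets_BE` / `exceptional_BE`: for `Y = B × E` with `B` of type `{0,1,2}` and
`E` of the `k`-type `{odd}` (the induced corner `{1,3,5}` restricted to `k`), Pohlmann's criterion gives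
`dim B²(Y) = 8 = 6 + 2`: two exceptional classes `{0,2,4} ⊔ {e₀}` and `{1,3,5} ⊔ {e₁}` of Künneth multidegree `(3,1)` —
exactly the two generators `⋀³(H¹(B)_τ) ⊗ H¹(E)_τ` of the `k`-WEIL PLANE of the Weil-type fourfold `(B × E, k)`, to
which Markman's theorem (tree record `Markman2025_weilClasses_algebraic_abelianFourfold`) applies.
Dictionary: [cite: Pohlmann1968, Thm 1] = `Literature.AlgebraicGeometry.GaoUllmo2025.theorem31` [cite: GaoUllmo2025, Thm 3.1];
Weil type of CM products [cite: MoonenZarhin1999, Introduction (g)].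

## References
* [Andre1992HodgeCM] Y. André, Une remarque à propos des cycles de Hodge de type CM, Progr. Math. 102 (1992), p. 2 and Théorème.
* [Pohlmann1968] H. Pohlmann, Ann. of Math. 88 (1968), Thm 1.  [GaoUllmo2025] Z. Gao, E. Ullmo, JIMJ 25 (2025), Thm 3.1.
* [MoonenZarhin1999] B. Moonen, Yu. Zarhin, Math. Ann. 315 (1999), Introduction (g) (`E × B` with `k ⊂` the CM field of `B`).

## Provenance
Seat scripts `g2/scratch/face_census.py` (48 faces, pattern `((1,1,3),(3,3,1))`, all Markman-coherent), `pohlmann_core.py`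
(`C6: B¹ = 4, B² = 8, D² = 6, exceptional 2 of type ((0,3),(1,1))`); copies in `run/shared/lean/pub/pub-hodgecm2/pub-hodgecm2-lit-andre-3/g2/`.
-/

namespace Summit.HodgeConjecture.CorCM.Census.CyclicSexticFaces

open Finset

/-- Boolean test: `T ⊂ ℤ/6` is a CM type (exactly one of `i`, `i + 3`). [folklore] -/
def isCMType (T : Finset (ZMod 6)) : Bool := decide (∀ i : ZMod 6, (i ∈ T ↔ i + 3 ∉ T))

/-- The eight CM types of the cyclic sextic field. [folklore] -/
def cmTypes : Finset (Finset (ZMod 6)) := (univ : Finset (ZMod 6)).powersetCard 3 |>.filter fun T => isCMType T = true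

/-- Conjugate type `T̄ = T + 3`. [folklore] -/
def bar (T : Finset (ZMod 6)) : Finset (ZMod 6) := T.image fun i => i + 3

/-- Flip at the place `{p, p+3}`: `T ∆ {p, p+3}` (the tree's `CMTypeOps.flip`). [folklore] -/
def flip (p : ZMod 6) (T : Finset (ZMod 6)) : Finset (ZMod 6) := symmDiff T {p, p + 3}

/-- The four corners of the face `(Φ; π, π′)`, verbatim `Face.corner`: `Φ, flip_π Φ̄, flip_π′ Φ̄, flip_π′ (flip_π Φ)`.
[cite: Andre1992HodgeCM, p. 2] -/
def corners (Φ : Finset (ZMod 6)) (p p' : ZMod 6) : List (Finset (ZMod 6)) :=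
  [Φ, flip p (bar Φ), flip p' (bar Φ), flip p' (flip p Φ)]

/-- The faces: a CM type and two distinct places (`p, p′ ∈ {0,1,2}`, `p ≠ p′`). [folklore] -/
def faces : Finset (Finset (ZMod 6) × ZMod 6 × ZMod 6) :=
  (cmTypes ×ˢ (({0, 1, 2} : Finset (ZMod 6)) ×ˢ ({0, 1, 2} : Finset (ZMod 6)))).filter fun f => f.2.1 ≠ f.2.2

/-- Boolean test: `T` is induced from the quadratic subfield `k = F^{⟨σ²⟩}` (`T + 2 = T`). [folklore] -/
def isInduced (T : Finset (ZMod 6)) : Bool := decide (T.image (fun i => i + 2) = T)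

set_option maxRecDepth 8000 in
set_option maxHeartbeats 4000000 in
/-- There are `8` CM types and `48` faces; `2` types are `k`-induced (`{0,2,4}`, `{1,3,5}`), `6` are primitive and form
ONE translation orbit of `{0,1,2}`. [folklore] -/
theorem counts : cmTypes.card = 8 ∧ faces.card = 48 ∧ (cmTypes.filter fun T => isInduced T = true) = { {0, 2, 4}, {1, 3, 5} } ∧
    (∀ T ∈ cmTypes, isInduced T = false → ∃ m : ZMod 6, T = ({0, 1, 2} : Finset (ZMod 6)).image fun i => i + m) := by
  refine ⟨by decide +kernel, by decide +kernel, by decide +kernel, by decide +kernel⟩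

set_option maxRecDepth 8000 in
set_option maxHeartbeats 4000000 in
/-- **SumTwo** (rfwf Lemma 1.2 in this model): for every face and every embedding `i`, exactly two of the four corners
contain `i` — the face Weil line is of Hodge type `(2,2)`. [cite: Andre1992HodgeCM, p. 2] -/
theorem sumTwo : ∀ f ∈ faces, ∀ i : ZMod 6, ((corners f.1 f.2.1 f.2.2).filter fun T => i ∈ T).length = 2 := by
  decide +kernel

set_option maxRecDepth 8000 in
set_option maxHeartbeats 4000000 in
/-- **Corner structure of every face of a cyclic sextic CM field**: the four corners are pairwise distinct CM types,
exactly one is `k`-induced, and the three primitive ones form a full packet `{Ψ, Ψ+2, Ψ+4}` (twists of one simple CM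
threefold `B` by a coset of `Gal(F/k) = ⟨σ²⟩`).  This is the combinatorial half of F-6: the core of every face is the
CM fourfold `B × E`. [folklore] -/
theorem corner_structure : ∀ f ∈ faces,
    (corners f.1 f.2.1 f.2.2).Nodup ∧ (∀ T ∈ corners f.1 f.2.1 f.2.2, T ∈ cmTypes) ∧
    ((corners f.1 f.2.1 f.2.2).filter fun T => isInduced T = true).length = 1 ∧
    (∃ Ψ ∈ corners f.1 f.2.1 f.2.2, isInduced Ψ = false ∧
      Ψ.image (fun i => i + 2) ∈ corners f.1 f.2.1 f.2.2 ∧ Ψ.image (fun i => i + 4) ∈ corners f.1 f.2.1 f.2.2) := by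
  decide +kernel

/-! ### Pohlmann census of the core `Y = B × E` -/

/-- Points `Hom(F,ℚ̄) ⊔ Hom(k,ℚ̄) = ℤ/6 ⊔ ℤ/2` (the restriction `ℤ/6 → ℤ/2` is reduction mod 2, `Gal(F/k) = ⟨2⟩`). [folklore] -/
abbrev Pt : Type := ZMod 6 ⊕ ZMod 2

/-- Galois action of `σᵍ`: `i ↦ i + g` on both blocks. [folklore] -/
def act (g : ZMod 6) : Pt → Pt
  | Sum.inl i => Sum.inl (i + g)
  | Sum.inr j => Sum.inr (j + (g.val : ZMod 2))

/-- CM type of `Y = B × E`: `B` of type `{0,1,2}`, `E` of type `{1} ⊂ ℤ/2` (the restriction of the induced corner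
`{1,3,5}`). [folklore] -/
def phi : Finset Pt := {Sum.inl 0, Sum.inl 1, Sum.inl 2, Sum.inr 1}

/-- Pohlmann's condition with multiplicity `m`. [cite: GaoUllmo2025, Thm 3.1 eq. (3.2)] -/
def eq32 (m : ℕ) (P : Finset Pt) : Bool := decide (∀ g : ZMod 6, (P.filter fun x => act g x ∈ phi).card = m)

/-- Pohlmann `4`-sets of `B × E` (basis of `B²(B × E) ⊗ ℚ̄`). [cite: GaoUllmo2025, Thm 3.1] -/
def hodgeSets : Finset (Finset Pt) := ((univ : Finset Pt).powersetCard 4).filter fun P => eq32 2 P = true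

/-- Pohlmann `2`-sets (basis of `B¹`). [cite: GaoUllmo2025, Thm 3.1] -/
def divisorSets : Finset (Finset Pt) := ((univ : Finset Pt).powersetCard 2).filter fun P => eq32 1 P = true

set_option maxRecDepth 8000 in
set_option maxHeartbeats 4000000 in
/-- **`B × E`**: `B¹ = 4` (the conjugate pairs: `ρ(B) + ρ(E) = 3 + 1`), `B² = 8`, and the Pohlmann `4`-sets NOT stable
under `c = σ³` are exactly `{σ⁰,σ²,σ⁴} ⊔ {e₀}` and `{σ¹,σ³,σ⁵} ⊔ {e₁}` — Künneth multidegree `(3,1)`, each the full fibre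
of ONE embedding `τ` of `k` on `B` times the embedding of `E` over the same `τ` (`i ↦ i mod 2`): the two eigen-generators
`⋀³ H¹(B)_τ ⊗ H¹(E)_τ` of the WEIL PLANE `⋀⁴_k H¹(B × E)` of the Weil-type fourfold `(B × E, k)`; hence
`B²(B × E) = D² ⊕ W_k`, `dim W_k = 2`. [cite: GaoUllmo2025, Thm 3.1] [cite: MoonenZarhin1999, Introduction (g)] -/
theorem census_BE : divisorSets.card = 4 ∧ hodgeSets.card = 8 ∧
    (hodgeSets.filter fun P => ∃ x ∈ P, act 3 x ∉ P) =
      { {Sum.inl 0, Sum.inl 2, Sum.inl 4, Sum.inr 0}, {Sum.inl 1, Sum.inl 3, Sum.inl 5, Sum.inr 1} } := by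
  refine ⟨by decide +kernel, by decide +kernel, by decide +kernel⟩

end Summit.HodgeConjecture.CorCM.Census.CyclicSexticFaces
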